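import Mathlib
import Literature.AlgebraicGeometry.Resolution.CompletedChainPointStep
import Literature.AlgebraicGeometry.Resolution.PreparedCentre
import Literature.AlgebraicGeometry.Resolution.PreparednessTransportCurve
import Literature.AlgebraicGeometry.Resolution.CurveStepPrepared
import HarnessLib

/-!
# The curve step of the transport down the completed chain (`τ = 1` endgame, brick B5-cv)

Topic: `Literature/AlgebraicGeometry/Resolution`. V. Cossart, U. Jannsen, S. Saito, LNM 2270 (2020),
Lemma 12.4 and proof of Thm. 13.7 / Claim 13.8 [cite: CossartJannsenSaito2020, Lemma 12.4];
V. Cossart, O. Piltant, J. Algebra 320 (2008), Lemma 4.5 (1) and proof of Prop. 4.4 p. 11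
[cite: CossartPiltant2008, Lemma 4.5]; H. Matsumura, *Commutative Ring Theory*, §8 [cite: Matsumura1987, Thm. 8.11].

OURS (brick B5-cv of the N2 assembly, architecture (B)): ONE CURVE STEP of the transport of the prepared
adapted system `x = (ŷ, u, ŵ)` of `R̂` down the `u`-chart of the blowing up of the centre `P = (y₁, u)`
(`I ⊆ P^μ`, contract clause `hcurve`; `(y₁, u, w)` a centred adapted label of `R` with `ŵ ≡ w mod 𝔪̂²`):
by `PreparedCentre` the prepared `ŷ` lies on `P R̂` and `I R̂ ⊆ (ŷ, u)^μ`; `ŷ ≡ α y₁ mod (u)` with `α` a unit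
and — both labels being adapted — `ŷ = α y₁ + β u` with `β ∈ 𝔪̂`; the transported system
`x' = (ŷ/u, φ u, φ̂ ŵ)` generates `𝔪̂'`, is prepared at every vertex, adapted, with non-empty polygon and a
monic element, and the approximation of `ŵ` is kept. F-71 / T1 / N2 NOT proved; no summit statement is proved.
-/

noncomputable section

open IsLocalRing MvPolynomial

namespace Literature.AlgebraicGeometry.Resolution

universe u

/-! ## Small tools -/

section Tools

variable {S : Type u} [CommRing S]

/-- `span (range c) = span {c 0, c 1, c 2}` for `c : Fin 3 → S`. [folklore] -/
private theorem span_range_fin3 (c : Fin 3 → S) :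
    Ideal.span (Set.range c) = Ideal.span {c 0, c 1, c 2} := by
  congr 1
  ext z
  simp only [Set.mem_range, Set.mem_insert_iff, Set.mem_singleton_iff]
  constructor
  · rintro ⟨i, rfl⟩; fin_cases i <;> simp
  · rintro (h | h | h) <;> exact ⟨_, h.symm⟩

/-- `(e a + q d + s b, b, d + m) = 𝔪` from `(a, b, d) = 𝔪` for a unit `e` and `m ∈ 𝔪²`. [folklore] -/
private theorem span_triple_eq_of_unit_shear [IsRegularLocalRing S] {a b d : S}
    (hgen : Ideal.span ({a, b, d} : Set S) = maximalIdeal S) {e : S} (he : IsUnit e) (q s m : S)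
    (hm : m ∈ maximalIdeal S ^ 2) :
    Ideal.span ({e * a + q * d + s * b, b, d + m} : Set S) = maximalIdeal S := by
  -- first `(e a + q d + s b, b, d) = (a, b, d)`
  have h1 : Ideal.span ({e * a + q * d + s * b, b, d} : Set S) = Ideal.span {a, b, d} := by
    apply le_antisymm
    · rw [Ideal.span_le, Set.insert_subset_iff, Set.insert_subset_iff, Set.singleton_subset_iff]
      refine ⟨?_, Ideal.subset_span (by simp), Ideal.subset_span (by simp)⟩
      exact Ideal.add_mem _ (Ideal.add_mem _ (Ideal.mul_mem_left _ _ (Ideal.subset_span (by simp)))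
        (Ideal.mul_mem_left _ _ (Ideal.subset_span (by simp)))) (Ideal.mul_mem_left _ _ (Ideal.subset_span (by simp)))
    · rw [Ideal.span_le, Set.insert_subset_iff, Set.insert_subset_iff, Set.singleton_subset_iff]
      have hb : b ∈ Ideal.span ({e * a + q * d + s * b, b, d} : Set S) := Ideal.subset_span (by simp)
      have hd : d ∈ Ideal.span ({e * a + q * d + s * b, b, d} : Set S) := Ideal.subset_span (by simp)
      refine ⟨?_, hb, hd⟩
      have h0 : e * a + q * d + s * b ∈ Ideal.span ({e * a + q * d + s * b, b, d} : Set S) :=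
        Ideal.subset_span (by simp)
      have h := Ideal.sub_mem _ (Ideal.sub_mem _ h0 (Ideal.mul_mem_left _ q hd)) (Ideal.mul_mem_left _ s hb)
      have hea : e * a = e * a + q * d + s * b - q * d - s * b := by ring
      obtain ⟨v, hv⟩ := he
      have key : (↑v⁻¹ : S) * (e * a + q * d + s * b - q * d - s * b) = a := by
        rw [← hea, ← hv, ← mul_assoc, Units.inv_mul, one_mul]
      have hmem := Ideal.mul_mem_left _ (↑v⁻¹ : S) h
      rwa [key] at hmem
  -- then perturb the third member modulo `𝔪²`
  have hgen1 : Ideal.span ({e * a + q * d + s * b, b, d} : Set S) = maximalIdeal S := by rw [h1, hgen]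
  have hr := span_range_eq_of_span_triple (![e * a + q * d + s * b, b, d]) hgen1
  have hdiff : ∀ i, (![e * a + q * d + s * b, b, d + m] : Fin 3 → S) i -
      (![e * a + q * d + s * b, b, d] : Fin 3 → S) i ∈ maximalIdeal S ^ 2 := by
    intro i; fin_cases i
    · simp
    · simp
    · show d + m - d ∈ _; rw [add_sub_cancel_left]; exact hm
  have h := span_range_eq_of_sub_mem_sq hr hdiff
  rw [span_range_fin3] at h
  exact h

variable [IsRegularLocalRing S] (c : Fin 3 → S)
  (hgen : Ideal.span {c 0, c 1, c 2} = maximalIdeal S) (hdim : ringKrullDim S = 3) {J : Ideal S} {μ : ℕ}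

include hdim in
/-- `𝔪` needs exactly three generators. [folklore] -/
private theorem spanFinrank_eq_three' : (maximalIdeal S).spanFinrank = 3 := by
  have h := IsRegularLocalRing.spanFinrank_maximalIdeal (R := S)
  rw [hdim] at h
  exact_mod_cast h

include hgen hdim in
/-- If `(α y + β u₁, u₁, u₂) = 𝔪 = (y, u₁, u₂)` then `α` is a unit (Nakayama). [folklore] -/
private theorem isUnit_of_span_triple_eq {α β : S}
    (hgen' : Ideal.span {α * c 0 + β * c 1, c 1, c 2} = maximalIdeal S) : IsUnit α := by
  by_contra hα
  have hαm : α ∈ maximalIdeal S := (mem_maximalIdeal _).mpr hα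
  have hc0m : c 0 ∈ maximalIdeal S := hgen ▸ Ideal.subset_span (by simp)
  have hle' : (Ideal.span ({α * c 0 + β * c 1, c 1, c 2} : Set S) : Submodule S S) ≤
      (Ideal.span ({c 1, c 2} : Set S) : Submodule S S) ⊔
        (maximalIdeal S : Ideal S) • (maximalIdeal S : Submodule S S) := by
    rw [Ideal.span_le, Set.insert_subset_iff, Set.insert_subset_iff, Set.singleton_subset_iff]
    refine ⟨?_, ?_, ?_⟩
    · refine Submodule.mem_sup.mpr ⟨β * c 1, ?_, α * c 0, ?_, by ring⟩
      · exact Ideal.mul_mem_left _ _ (Ideal.subset_span (by simp))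
      · rw [Ideal.smul_eq_mul]; exact Ideal.mul_mem_mul hαm hc0m
    · exact Submodule.mem_sup_left (Ideal.subset_span (by simp))
    · exact Submodule.mem_sup_left (Ideal.subset_span (by simp))
  have hle : (maximalIdeal S : Submodule S S) ≤
      (Ideal.span ({c 1, c 2} : Set S) : Submodule S S) ⊔
        (maximalIdeal S : Ideal S) • (maximalIdeal S : Submodule S S) :=
    calc (maximalIdeal S : Submodule S S) = Ideal.span ({α * c 0 + β * c 1, c 1, c 2} : Set S) := hgen'.symm
      _ ≤ _ := hle'
  have hjac : (maximalIdeal S) ≤ (⊥ : Ideal S).jacobson := IsLocalRing.maximalIdeal_le_jacobson _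
  have hfg : (maximalIdeal S : Submodule S S).FG := (maximalIdeal S).fg_of_isNoetherianRing
  have hm : (maximalIdeal S : Submodule S S) ≤ Ideal.span ({c 1, c 2} : Set S) :=
    Submodule.le_of_le_smul_of_le_jacobson_bot hfg hjac hle
  have hfr := spanFinrank_eq_three' hdim
  have heq : Ideal.span ({c 1, c 2} : Set S) = maximalIdeal S := by
    refine le_antisymm ?_ hm
    rw [← hgen]; exact Ideal.span_mono (by intro x hx; rcases hx with rfl | rfl <;> simp)
  have hfin : ({c 1, c 2} : Set S).Finite := Set.toFinite _
  have hcard : (Ideal.span ({c 1, c 2} : Set S)).spanFinrank ≤ ({c 1, c 2} : Set S).ncard :=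
    Submodule.spanFinrank_span_le_ncard_of_finite hfin
  have h2 : ({c 1, c 2} : Set S).ncard ≤ 2 := (Set.ncard_insert_le _ _).trans (by rw [Set.ncard_singleton])
  rw [heq, hfr] at hcard
  omega

include hgen hdim in
/-- **Two adapted first members define the same tangent direction**: if `c = (y, u₁, u₂)` is adapted to
`J ⊆ 𝔪^μ` (`J ⊄ 𝔪^{μ+1}`) and so is `(y₁, u₁, u₂)` where `y = α y₁ + β u₁` with `α` a unit, then
`β ∈ 𝔪`. [cite: CossartJannsenSaito2020, (12.1)] [cite: CossartPiltant2008, (10)] -/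
private theorem mem_maximalIdeal_of_adapted_pair (hμ : 0 < μ) (hJμ : J ≤ maximalIdeal S ^ μ)
    (hJne : ¬ J ≤ maximalIdeal S ^ (μ + 1))
    (had : ∀ G ∈ initialForms c J μ, ∃ a : ResidueField S, G = C a * X 0 ^ μ)
    {y₁ α β : S} (hα : IsUnit α) (hy : c 0 = α * y₁ + β * c 1)
    (hgen₁ : Ideal.span {y₁, c 1, c 2} = maximalIdeal S)
    (had₁ : ∀ G ∈ initialForms ![y₁, c 1, c 2] J μ, ∃ a : ResidueField S, G = C a * X 0 ^ μ) :
    β ∈ maximalIdeal S := by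
  classical
  have h1 : ∀ i, 0 < (fun _ : Fin 3 => (1 : ℕ)) i := fun _ => Nat.one_pos
  set c₁ : Fin 3 → S := ![y₁, c 1, c 2] with hc₁
  have hgen₁' : Ideal.span {c₁ 0, c₁ 1, c₁ 2} = maximalIdeal S := hgen₁
  have hgenr₁ := span_range_eq_of_span_triple c₁ hgen₁'
  obtain ⟨g, hgJ, hg⟩ := SetLike.not_le_iff_exists.mp hJne
  obtain ⟨f, hgf⟩ := exists_sub_mul_pow_mem_of_forall_initialForms c hgen hdim hJμ had hgJ
  have hfu : IsUnit f := by
    by_contra hf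
    apply hg
    have hfm : f ∈ maximalIdeal S := (mem_maximalIdeal _).mpr hf
    have : f * c 0 ^ μ ∈ maximalIdeal S ^ (μ + 1) := by
      rw [pow_succ']; exact Ideal.mul_mem_mul hfm (Ideal.pow_mem_pow (hgen ▸ Ideal.subset_span (by simp)) μ)
    simpa using Ideal.add_mem _ hgf this
  -- the form `f (α Y₁ + β U)^μ` is the initial form of `g` w.r.t. `c₁`
  set F : MvPolynomial (Fin 3) S := C f * (C α * X 0 + C β * X 1) ^ μ with hF
  have hFhom : F.IsWeightedHomogeneous (fun _ => (1 : ℕ)) μ := by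
    rw [isWeightedHomogeneous_one_iff]
    have hlin : (C α * X 0 + C β * X 1 : MvPolynomial (Fin 3) S).IsHomogeneous 1 :=
      ((isHomogeneous_C _ α).mul (isHomogeneous_X S 0)).add ((isHomogeneous_C _ β).mul (isHomogeneous_X S 1))
    have := (isHomogeneous_C (Fin 3) f).mul (hlin.pow μ)
    rwa [zero_add, one_mul] at this
  have hFeval : eval c₁ F = f * c 0 ^ μ := by
    simp only [hF, map_mul, eval_C, map_pow, map_add, eval_X, hc₁, Matrix.cons_val_zero, Matrix.cons_val_one,
      hy]
  have hin : IsInForm c₁ (fun _ => 1) μ g (MvPolynomial.map (residue S) F) :=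
    ⟨F, hFhom, rfl, by rw [weightedIdealW_one_eq_pow c₁ hgenr₁, hFeval]; exact hgf⟩
  have heq := hin.eq_inForm c₁ hgen₁' hdim h1
  obtain ⟨a, ha⟩ := had₁ _ ((mem_initialForms_iff_exists_inForm c₁ hgen₁' hdim hJμ _).mpr ⟨g, hgJ, rfl⟩)
  rw [ha] at heq
  -- compare the `U^μ` coefficients
  have hαr : residue S α ≠ 0 := by
    intro h0; rw [residue_eq_zero_iff] at h0; exact (mem_maximalIdeal _).mp h0 hα
  have hfac : (C (residue S α) * X 0 + C (residue S β) * X 1 : MvPolynomial (Fin 3) (ResidueField S)) =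
      C (residue S α) * (X 0 + C (residue S β / residue S α) * X 1 + C 0 * X 2) := by
    rw [C_0, zero_mul, add_zero, mul_add, ← mul_assoc, ← C_mul, mul_div_cancel₀ _ hαr]
  have hcoef := congrArg (MvPolynomial.coeff (Finsupp.single (1 : Fin 3) μ)) heq
  rw [hF, map_mul, map_C, map_pow, map_add, map_mul, map_C, map_X, map_mul, map_C, map_X, hfac, mul_pow,
    ← C_pow, ← mul_assoc, ← C_mul, coeff_C_mul, coeff_linearPow_single_one, coeff_C_mul, coeff_X_pow,
    if_neg (by rw [Finsupp.single_eq_single_iff]; omega)] at hcoef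
  rw [mul_zero] at hcoef
  have hfr0 : residue S f ≠ 0 := by
    intro h0; rw [residue_eq_zero_iff] at h0; exact (mem_maximalIdeal _).mp h0 hfu
  have : (residue S β / residue S α) ^ μ = 0 := by
    rcases mul_eq_zero.mp hcoef with h | h
    · exact absurd h (mul_ne_zero hfr0 (pow_ne_zero _ hαr))
    · exact h
  have hβ0 : residue S β = 0 := by
    have := pow_eq_zero_iff (Nat.pos_iff_ne_zero.mp hμ) |>.mp this
    rwa [div_eq_zero_iff, or_iff_left hαr] at this
  rwa [residue_eq_zero_iff] at hβ0

end Tools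

/-! ## The curve step -/

section CurveStep

variable {R R' : Type u} [CommRing R] [CommRing R'] [IsRegularLocalRing R] [IsRegularLocalRing R']
  (φ : R →+* R') [IsLocalHom φ] (hφm : (maximalIdeal R).map φ ≤ maximalIdeal R')
  (hdim : ringKrullDim R = 3) (hdim' : ringKrullDim R' = 3)

include hdim hdim' in
/-- **B5-cv (OURS). The curve step of the transport down the completed chain.** See the module docstring.
[cite: CossartJannsenSaito2020, Lemma 12.4, Thm. 13.7 (proof)] [cite: CossartPiltant2008, Lemma 4.5 (1)]
[cite: Matsumura1987, Thm. 8.11] -/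
theorem completedChain_curve_step
    (hres : Function.Surjective (ResidueField.map φ))
    {I : Ideal R} {I' : Ideal R'} {μ : ℕ} (u : R)
    (hIμ : I ≤ maximalIdeal R ^ μ) (hIne : ¬ I ≤ maximalIdeal R ^ (μ + 1))
    (hIμ' : I' ≤ maximalIdeal R' ^ μ) (hIne' : ¬ I' ≤ maximalIdeal R' ^ (μ + 1))
    (hI : I' = (I.map φ).colon {φ u ^ μ})
    (hτ' : ∀ c' : Fin 3 → R', Ideal.span {c' 0, c' 1, c' 2} = maximalIdeal R' → hironakaTauAt c' I' μ = 1)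
    (P : Ideal R) (hIP : I ≤ P ^ μ)
    (hcurve : ∀ (y w : R), Ideal.span {y, u} = P → Ideal.span {y, u, w} = maximalIdeal R →
      (∀ G ∈ initialForms ![y, u, w] I μ, ∃ a : ResidueField R, G = C a * X 0 ^ μ) →
      ∃ y' : R', φ y = φ u * y' ∧ Ideal.span {y', φ u, φ w} = maximalIdeal R')
    [IsRegularLocalRing (AdicCompletion (maximalIdeal R) R)] [IsRegularLocalRing (AdicCompletion (maximalIdeal R') R')]
    (x : Fin 3 → (AdicCompletion (maximalIdeal R) R)) (hx1 : x 1 = (algebraMap R (AdicCompletion (maximalIdeal R) R)) u)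
    (hgenx : Ideal.span {x 0, x 1, x 2} = maximalIdeal (AdicCompletion (maximalIdeal R) R))
    (hprep : ∀ B, PreparedUpTo x (I.map (algebraMap R (AdicCompletion (maximalIdeal R) R))) μ B)
    (hne : (pts x (I.map (algebraMap R (AdicCompletion (maximalIdeal R) R))) μ).Nonempty)
    (hδ : μ.factorial < deltaS x (I.map (algebraMap R (AdicCompletion (maximalIdeal R) R))) μ)
    (y₁ w : R) (hy₁P : Ideal.span {y₁, u} = P) (hgen₁ : Ideal.span {y₁, u, w} = maximalIdeal R)
    (had₁ : ∀ G ∈ initialForms ![y₁, u, w] I μ, ∃ a : ResidueField R, G = C a * X 0 ^ μ)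
    (hw : x 2 - (algebraMap R (AdicCompletion (maximalIdeal R) R)) w ∈ maximalIdeal (AdicCompletion (maximalIdeal R) R) ^ 2) :
    ∃ x' : Fin 3 → (AdicCompletion (maximalIdeal R') R'),
      x' 1 = (algebraMap R' (AdicCompletion (maximalIdeal R') R')) (φ u) ∧
      Ideal.span {x' 0, x' 1, x' 2} = maximalIdeal (AdicCompletion (maximalIdeal R') R') ∧
      (adicCompletionMap (maximalIdeal R) (maximalIdeal R') φ hφm) (x 0) = (adicCompletionMap (maximalIdeal R) (maximalIdeal R') φ hφm) (x 1) * x' 0 ∧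
      x' 2 = (adicCompletionMap (maximalIdeal R) (maximalIdeal R') φ hφm) (x 2) ∧
      I.map (algebraMap R (AdicCompletion (maximalIdeal R) R)) ≤ Ideal.span {x 0, x 1} ^ μ ∧
      (∀ B, PreparedUpTo x' (I'.map (algebraMap R' (AdicCompletion (maximalIdeal R') R'))) μ B) ∧
      (pts x' (I'.map (algebraMap R' (AdicCompletion (maximalIdeal R') R'))) μ).Nonempty ∧
      μ.factorial < deltaS x' (I'.map (algebraMap R' (AdicCompletion (maximalIdeal R') R'))) μ ∧
      HasMonic x' (I'.map (algebraMap R' (AdicCompletion (maximalIdeal R') R'))) μ ∧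
      (∀ (w₁ : R) (k : ℕ), x 2 - (algebraMap R (AdicCompletion (maximalIdeal R) R)) w₁ ∈ maximalIdeal (AdicCompletion (maximalIdeal R) R) ^ k →
        x' 2 - (algebraMap R' (AdicCompletion (maximalIdeal R') R')) (φ w₁) ∈ maximalIdeal (AdicCompletion (maximalIdeal R') R') ^ k) := by
  classical
  have hL := Nat.factorial_pos μ
  have hdimA : ringKrullDim (AdicCompletion (maximalIdeal R) R) = 3 := by rw [ringKrullDim_adicCompletion, hdim]
  have hdimB : ringKrullDim (AdicCompletion (maximalIdeal R') R') = 3 := by rw [ringKrullDim_adicCompletion, hdim']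
  have hfrB : (maximalIdeal (AdicCompletion (maximalIdeal R') R')).spanFinrank = 3 := by
    have h := IsRegularLocalRing.spanFinrank_maximalIdeal (R := (AdicCompletion (maximalIdeal R') R'))
    rw [hdimB] at h
    exact_mod_cast h
  haveI hφHloc : IsLocalHom (adicCompletionMap (maximalIdeal R) (maximalIdeal R') φ hφm) := isLocalHom_adicCompletionMap' φ hφm
  haveI : IsDomain R' := isDomain_of_isRegularLocalRing R'
  haveI : IsDomain (AdicCompletion (maximalIdeal R') R') := isDomain_of_isRegularLocalRing _
  have hψ := residueField_map_adicCompletionMap_surjective φ hφm hres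
  have hmA : maximalIdeal (AdicCompletion (maximalIdeal R) R) = (maximalIdeal R).map (algebraMap R (AdicCompletion (maximalIdeal R) R)) := AdicCompletion.maximalIdeal_eq_map
  have hmB : maximalIdeal (AdicCompletion (maximalIdeal R') R') = (maximalIdeal R').map (algebraMap R' (AdicCompletion (maximalIdeal R') R')) := AdicCompletion.maximalIdeal_eq_map
  have hIμA : I.map (algebraMap R (AdicCompletion (maximalIdeal R) R)) ≤ maximalIdeal (AdicCompletion (maximalIdeal R) R) ^ μ := map_le_pow_maximalIdeal_adicCompletion hIμ
  have hIneA : ¬ I.map (algebraMap R (AdicCompletion (maximalIdeal R) R)) ≤ maximalIdeal (AdicCompletion (maximalIdeal R) R) ^ (μ + 1) := not_map_le_pow_maximalIdeal_adicCompletion hIne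
  have hIμB : I'.map (algebraMap R' (AdicCompletion (maximalIdeal R') R')) ≤ maximalIdeal (AdicCompletion (maximalIdeal R') R') ^ μ := map_le_pow_maximalIdeal_adicCompletion hIμ'
  have hIneB : ¬ I'.map (algebraMap R' (AdicCompletion (maximalIdeal R') R')) ≤ maximalIdeal (AdicCompletion (maximalIdeal R') R') ^ (μ + 1) := not_map_le_pow_maximalIdeal_adicCompletion hIne'
  have hgenxr := span_range_eq_of_span_triple x hgenx
  have hmonx : HasMonic x (I.map (algebraMap R (AdicCompletion (maximalIdeal R) R))) μ := hasMonic_of_lt_deltaS x hgenx hdimA hIμA hIneA hδ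
  have hadx := forall_initialForms_of_lt_deltaS x hgenx hdimA hIμA hδ
  -- (A) the centred label in `R̂`: `c₁ = (ι y₁, ι u, x 2)` generates `𝔪̂` and is adapted
  have hgen₁ι' : Ideal.span {(algebraMap R (AdicCompletion (maximalIdeal R) R)) y₁, (algebraMap R (AdicCompletion (maximalIdeal R) R)) u, (algebraMap R (AdicCompletion (maximalIdeal R) R)) w} = maximalIdeal (AdicCompletion (maximalIdeal R) R) := by
    have h := congrArg (Ideal.map (algebraMap R (AdicCompletion (maximalIdeal R) R))) hgen₁
    rw [Ideal.map_span, Set.image_insert_eq, Set.image_insert_eq, Set.image_singleton, ← hmA] at h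
    exact h
  have hgen₁A : Ideal.span {(algebraMap R (AdicCompletion (maximalIdeal R) R)) y₁, x 1, x 2} = maximalIdeal (AdicCompletion (maximalIdeal R) R) := by
    rw [hx1]
    have hr := span_range_eq_of_span_triple (![(algebraMap R (AdicCompletion (maximalIdeal R) R)) y₁, (algebraMap R (AdicCompletion (maximalIdeal R) R)) u, (algebraMap R (AdicCompletion (maximalIdeal R) R)) w]) hgen₁ι'
    have hdiff : ∀ i, (![(algebraMap R (AdicCompletion (maximalIdeal R) R)) y₁, (algebraMap R (AdicCompletion (maximalIdeal R) R)) u, x 2] : Fin 3 → (AdicCompletion (maximalIdeal R) R)) i -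
        (![(algebraMap R (AdicCompletion (maximalIdeal R) R)) y₁, (algebraMap R (AdicCompletion (maximalIdeal R) R)) u, (algebraMap R (AdicCompletion (maximalIdeal R) R)) w] : Fin 3 → (AdicCompletion (maximalIdeal R) R)) i ∈ maximalIdeal (AdicCompletion (maximalIdeal R) R) ^ 2 := by
      intro i; fin_cases i
      · simp
      · simp
      · exact hw
    have h := span_range_eq_of_sub_mem_sq hr hdiff
    rw [span_range_fin3] at h
    exact h
  have had₁ι := forall_initialForms_map_adicCompletion (![y₁, u, w]) hgen₁ hdim hIμ had₁
  have had₁A : ∀ G ∈ initialForms ![(algebraMap R (AdicCompletion (maximalIdeal R) R)) y₁, x 1, x 2] (I.map (algebraMap R (AdicCompletion (maximalIdeal R) R))) μ,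
      ∃ a : ResidueField (AdicCompletion (maximalIdeal R) R), G = C a * X 0 ^ μ := by
    refine forall_initialForms_of_eq_zero (fun i => (algebraMap R (AdicCompletion (maximalIdeal R) R)) ((![y₁, u, w] : Fin 3 → R) i)) hdimA hIμA _ ?_
      hgen₁A rfl had₁ι
    exact hgen₁ι'
  -- (B) `PreparedCentre`: `I R̂ ⊆ (ŷ, u)^μ` and `ŷ ∈ (ι y₁, u) R̂`
  have hJP : I.map (algebraMap R (AdicCompletion (maximalIdeal R) R)) ≤ Ideal.span {(algebraMap R (AdicCompletion (maximalIdeal R) R)) y₁, x 1} ^ μ := by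
    rw [hx1]
    calc I.map (algebraMap R (AdicCompletion (maximalIdeal R) R)) ≤ (P ^ μ).map (algebraMap R (AdicCompletion (maximalIdeal R) R)) := Ideal.map_mono hIP
      _ = Ideal.span {(algebraMap R (AdicCompletion (maximalIdeal R) R)) y₁, (algebraMap R (AdicCompletion (maximalIdeal R) R)) u} ^ μ := by
          rw [Ideal.map_pow, ← hy₁P, Ideal.map_span, Set.image_insert_eq, Set.image_singleton]
  obtain ⟨hJc, hx0mem⟩ := le_span_pair_pow_and_mem_of_forall_preparedUpTo x hgenx hdimA hIμA hIneA hδ hmonx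
    hprep ((algebraMap R (AdicCompletion (maximalIdeal R) R)) y₁) hgen₁A hJP
  obtain ⟨α, β, hαβ⟩ := Ideal.mem_span_pair.mp hx0mem
  -- `hαβ : α * ι y₁ + β * x 1 = x 0`
  have hα : IsUnit α := by
    refine isUnit_of_span_triple_eq (![(algebraMap R (AdicCompletion (maximalIdeal R) R)) y₁, x 1, x 2]) hgen₁A hdimA (β := β) ?_
    show Ideal.span {α * (algebraMap R (AdicCompletion (maximalIdeal R) R)) y₁ + β * x 1, x 1, x 2} = _
    rw [hαβ]; exact hgenx
  have hμ : 0 < μ := by obtain ⟨e, he⟩ := hne; have := he.2; omega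
  have hβ : β ∈ maximalIdeal (AdicCompletion (maximalIdeal R) R) :=
    mem_maximalIdeal_of_adapted_pair x hgenx hdimA hμ hIμA hIneA hadx hα
      (by rw [← hαβ]) hgen₁A had₁A
  -- (C) the contract's curve step on the centred label
  obtain ⟨y₁', hy₁', hgen'⟩ := hcurve y₁ w hy₁P hgen₁ had₁
  -- `𝔪 R' = (φ u, φ w)`; `β ↦ p û + q ι'(φ w)`
  have hmapφ : (maximalIdeal R).map φ ≤ Ideal.span {φ u, φ w} := by
    rw [← hgen₁, Ideal.map_span, Ideal.span_le]
    rintro _ ⟨z, hz, rfl⟩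
    rcases hz with rfl | rfl | rfl
    · rw [SetLike.mem_coe, hy₁']; exact Ideal.mul_mem_right _ _ (Ideal.subset_span (by simp))
    · exact Ideal.subset_span (by simp)
    · exact Ideal.subset_span (by simp)
  have hβ' : (adicCompletionMap (maximalIdeal R) (maximalIdeal R') φ hφm) β ∈ Ideal.span {(algebraMap R' (AdicCompletion (maximalIdeal R') R')) (φ u), (algebraMap R' (AdicCompletion (maximalIdeal R') R')) (φ w)} := by
    have h1 : (adicCompletionMap (maximalIdeal R) (maximalIdeal R') φ hφm) β ∈ (maximalIdeal (AdicCompletion (maximalIdeal R) R)).map (adicCompletionMap (maximalIdeal R) (maximalIdeal R') φ hφm) := Ideal.mem_map_of_mem _ hβ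
    rw [hmA, Ideal.map_map, adicCompletionMap_comp_algebraMap' φ hφm, ← Ideal.map_map] at h1
    have h2 : ((maximalIdeal R).map φ).map (algebraMap R' (AdicCompletion (maximalIdeal R') R')) ≤ Ideal.span {(algebraMap R' (AdicCompletion (maximalIdeal R') R')) (φ u), (algebraMap R' (AdicCompletion (maximalIdeal R') R')) (φ w)} := by
      refine (Ideal.map_mono hmapφ).trans ?_
      rw [Ideal.map_span, Set.image_insert_eq, Set.image_singleton]
    exact h2 h1
  obtain ⟨p, q, hpq⟩ := Ideal.mem_span_pair.mp hβ'
  -- the transported system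
  have hû : (adicCompletionMap (maximalIdeal R) (maximalIdeal R') φ hφm) (x 1) = (algebraMap R' (AdicCompletion (maximalIdeal R') R')) (φ u) := by rw [hx1, adicCompletionMap_algebraMap]
  set x' : Fin 3 → (AdicCompletion (maximalIdeal R') R') :=
    ![(adicCompletionMap (maximalIdeal R) (maximalIdeal R') φ hφm) α * (algebraMap R' (AdicCompletion (maximalIdeal R') R')) y₁' + (adicCompletionMap (maximalIdeal R) (maximalIdeal R') φ hφm) β, (algebraMap R' (AdicCompletion (maximalIdeal R') R')) (φ u), (adicCompletionMap (maximalIdeal R) (maximalIdeal R') φ hφm) (x 2)] with hx'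
  have hx'0 : x' 0 = (adicCompletionMap (maximalIdeal R) (maximalIdeal R') φ hφm) α * (algebraMap R' (AdicCompletion (maximalIdeal R') R')) y₁' + (adicCompletionMap (maximalIdeal R) (maximalIdeal R') φ hφm) β := rfl
  have hx'1 : x' 1 = (algebraMap R' (AdicCompletion (maximalIdeal R') R')) (φ u) := rfl
  have hx'2 : x' 2 = (adicCompletionMap (maximalIdeal R) (maximalIdeal R') φ hφm) (x 2) := rfl
  have h₀ : (adicCompletionMap (maximalIdeal R) (maximalIdeal R') φ hφm) (x 0) = (adicCompletionMap (maximalIdeal R) (maximalIdeal R') φ hφm) (x 1) * x' 0 := by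
    rw [hû, hx'0, ← hαβ, map_add, map_mul, map_mul, adicCompletionMap_algebraMap, hy₁', map_mul, hû]; ring
  have h₁ : x' 1 = (adicCompletionMap (maximalIdeal R) (maximalIdeal R') φ hφm) (x 1) := by rw [hû, hx'1]
  have h₂ : x' 2 = (adicCompletionMap (maximalIdeal R) (maximalIdeal R') φ hφm) (x 2) := rfl
  -- `(x') = 𝔪̂'`
  have hgen'B : Ideal.span {(algebraMap R' (AdicCompletion (maximalIdeal R') R')) y₁', (algebraMap R' (AdicCompletion (maximalIdeal R') R')) (φ u), (algebraMap R' (AdicCompletion (maximalIdeal R') R')) (φ w)} = maximalIdeal (AdicCompletion (maximalIdeal R') R') := by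
    have h := congrArg (Ideal.map (algebraMap R' (AdicCompletion (maximalIdeal R') R'))) hgen'
    rw [Ideal.map_span, Set.image_insert_eq, Set.image_insert_eq, Set.image_singleton, ← hmB] at h
    exact h
  have hm2 : (adicCompletionMap (maximalIdeal R) (maximalIdeal R') φ hφm) (x 2) - (algebraMap R' (AdicCompletion (maximalIdeal R') R')) (φ w) ∈ maximalIdeal (AdicCompletion (maximalIdeal R') R') ^ 2 := by
    have : (adicCompletionMap (maximalIdeal R) (maximalIdeal R') φ hφm) (x 2) - (algebraMap R' (AdicCompletion (maximalIdeal R') R')) (φ w) = (adicCompletionMap (maximalIdeal R) (maximalIdeal R') φ hφm) (x 2 - (algebraMap R (AdicCompletion (maximalIdeal R) R)) w) := by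
      rw [map_sub, adicCompletionMap_algebraMap]
    rw [this]
    have h1 : (adicCompletionMap (maximalIdeal R) (maximalIdeal R') φ hφm) (x 2 - (algebraMap R (AdicCompletion (maximalIdeal R) R)) w) ∈ (maximalIdeal (AdicCompletion (maximalIdeal R) R) ^ 2).map (adicCompletionMap (maximalIdeal R) (maximalIdeal R') φ hφm) := Ideal.mem_map_of_mem _ hw
    rw [Ideal.map_pow] at h1
    exact Ideal.pow_right_mono (((IsLocalRing.local_hom_TFAE _).out 0 2).mp hφHloc) 2 h1
  have hgenB' : Ideal.span {x' 0, x' 1, x' 2} = maximalIdeal (AdicCompletion (maximalIdeal R') R') := by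
    rw [hx'0, hx'1, hx'2, ← hpq]
    have : (adicCompletionMap (maximalIdeal R) (maximalIdeal R') φ hφm) α * (algebraMap R' (AdicCompletion (maximalIdeal R') R')) y₁' + (p * (algebraMap R' (AdicCompletion (maximalIdeal R') R')) (φ u) + q * (algebraMap R' (AdicCompletion (maximalIdeal R') R')) (φ w)) =
        (adicCompletionMap (maximalIdeal R) (maximalIdeal R') φ hφm) α * (algebraMap R' (AdicCompletion (maximalIdeal R') R')) y₁' + q * (algebraMap R' (AdicCompletion (maximalIdeal R') R')) (φ w) + p * (algebraMap R' (AdicCompletion (maximalIdeal R') R')) (φ u) := by ring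
    rw [this]
    have hsplit : (adicCompletionMap (maximalIdeal R) (maximalIdeal R') φ hφm) (x 2) = (algebraMap R' (AdicCompletion (maximalIdeal R') R')) (φ w) + ((adicCompletionMap (maximalIdeal R) (maximalIdeal R') φ hφm) (x 2) - (algebraMap R' (AdicCompletion (maximalIdeal R') R')) (φ w)) := by ring
    rw [hsplit]
    exact span_triple_eq_of_unit_shear hgen'B (hα.map _) q p _ hm2
  have hgenB'r := span_range_eq_of_span_triple x' hgenB'
  -- (D) the weak transform in the completed chain
  have hJ' : I'.map (algebraMap R' (AdicCompletion (maximalIdeal R') R')) = ((I.map (algebraMap R (AdicCompletion (maximalIdeal R) R))).map (adicCompletionMap (maximalIdeal R) (maximalIdeal R') φ hφm)).colon {(adicCompletionMap (maximalIdeal R) (maximalIdeal R') φ hφm) (x 1) ^ μ} := by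
    rw [hx1]; exact weakTransform_adicCompletion_of_eq φ hφm hI
  -- (E) the polygon invariants transported
  have hprep' : ∀ B, PreparedUpTo x' (I'.map (algebraMap R' (AdicCompletion (maximalIdeal R') R'))) μ B := by
    intro B
    have h := preparedUpTo_colon_curve (adicCompletionMap (maximalIdeal R) (maximalIdeal R') φ hφm) h₁ h₀ h₂ hgenx hdimA hgenB' hdimB hψ hJc
      (show μ.factorial ≤ B + μ.factorial by omega) (hprep (B + μ.factorial))
    rw [Nat.add_sub_cancel, ← hJ'] at h
    exact h
  have hα1 : μ.factorial ≤ alphaS x (I.map (algebraMap R (AdicCompletion (maximalIdeal R) R))) μ :=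
    factorial_le_alphaS_of_le_span_pair_pow x hgenx hdimA hJc hne
  have hne' : (pts x' (I'.map (algebraMap R' (AdicCompletion (maximalIdeal R') R'))) μ).Nonempty := by
    have h := pts_colon_curve_nonempty (adicCompletionMap (maximalIdeal R) (maximalIdeal R') φ hφm) h₁ h₀ h₂ hgenx hdimA hgenB' hdimB hJc hne hδ hα1
    rw [← hJ'] at h
    exact h
  have hmon' : HasMonic x' (I'.map (algebraMap R' (AdicCompletion (maximalIdeal R') R'))) μ := by
    obtain ⟨g, hgJ, hg⟩ := SetLike.not_le_iff_exists.mp hIneA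
    obtain ⟨f, hfu, hgf⟩ := exists_monic_of_lt_deltaS x hgenx hdimA hIμA hδ hgJ hg
    obtain ⟨g', hg'⟩ := exists_eq_pow_mul_of_mem_pPow (adicCompletionMap (maximalIdeal R) (maximalIdeal R') φ hφm) h₀ (hJc hgJ)
    have hg'J : g' ∈ I'.map (algebraMap R' (AdicCompletion (maximalIdeal R') R')) := by
      rw [hJ', Submodule.mem_colon_singleton, smul_eq_mul, mul_comm, ← hg']
      exact Ideal.mem_map_of_mem _ hgJ
    have hφle : (maximalIdeal (AdicCompletion (maximalIdeal R) R)).map (adicCompletionMap (maximalIdeal R) (maximalIdeal R') φ hφm) ≤ Ideal.span {x' 1, x' 2} := by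
      rw [← hgenx, Ideal.map_span, Ideal.span_le]
      rintro _ ⟨z, hz, rfl⟩
      rcases hz with rfl | rfl | rfl
      · rw [SetLike.mem_coe, h₀, ← h₁]; exact Ideal.mul_mem_right _ _ (Ideal.subset_span (by simp))
      · rw [SetLike.mem_coe, ← h₁]; exact Ideal.subset_span (by simp)
      · rw [SetLike.mem_coe, ← h₂]; exact Ideal.subset_span (by simp)
    exact hasMonic_of_monic_of_chart (adicCompletionMap (maximalIdeal R) (maximalIdeal R') φ hφm) (c := x) (c' := x') hgenB' hdimB (j := 1) (Or.inl rfl) h₁ h₀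
      hφle hIμB hgf (hfu.map _) hg' hg'J
  have hτx' : hironakaTauAt x' (I'.map (algebraMap R' (AdicCompletion (maximalIdeal R') R'))) μ = 1 := by
    set c' : Fin 3 → R' := ![y₁', φ u, φ w] with hc'
    have hgc' : Ideal.span {c' 0, c' 1, c' 2} = maximalIdeal R' := hgen'
    have h1 := hironakaTauAt_map_adicCompletion c' hgc' hdim' hIμ'
    rw [hτ' c' hgc'] at h1
    have hgc'ι : Ideal.span (Set.range (fun i => (algebraMap R' (AdicCompletion (maximalIdeal R') R')) (c' i))) = maximalIdeal (AdicCompletion (maximalIdeal R') R') :=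
      span_range_algebraMap_adicCompletion_eq_maximalIdeal (span_range_eq_of_span_triple c' hgc')
    rw [← h1]
    exact hironakaTauAt_eq_of_rsop hfrB hgc'ι hgenB'r _ μ
  have hδ' : μ.factorial < deltaS x' (I'.map (algebraMap R' (AdicCompletion (maximalIdeal R') R'))) μ := by
    have hvp := vPrepared_of_preparedUpTo x' hgenB' hdimB hIμB hne' (le_refl _)
      (hprep' (alphaS x' (I'.map (algebraMap R' (AdicCompletion (maximalIdeal R') R'))) μ))
    exact lt_deltaS_of_preparedUpTo_of_hironakaTauAt_eq_one x' hgenB' hdimB hIμB hne' hτx' hmon' hvp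
      (Nat.le_add_left _ _) (hprep' (alphaS x' (I'.map (algebraMap R' (AdicCompletion (maximalIdeal R') R'))) μ + μ.factorial))
  refine ⟨x', hx'1, hgenB', h₀, hx'2, hJc, hprep', hne', hδ', hmon', fun w₁ k hk => ?_⟩
  -- (F) the approximation of `ŵ'` is kept
  rw [hx'2, ← adicCompletionMap_algebraMap φ hφm, ← map_sub]
  have h1 : (adicCompletionMap (maximalIdeal R) (maximalIdeal R') φ hφm) (x 2 - (algebraMap R (AdicCompletion (maximalIdeal R) R)) w₁) ∈ (maximalIdeal (AdicCompletion (maximalIdeal R) R) ^ k).map (adicCompletionMap (maximalIdeal R) (maximalIdeal R') φ hφm) := Ideal.mem_map_of_mem _ hk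
  rw [Ideal.map_pow] at h1
  exact Ideal.pow_right_mono (((IsLocalRing.local_hom_TFAE _).out 0 2).mp hφHloc) k h1

end CurveStep

end Literature.AlgebraicGeometry.Resolution

end
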